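import Literature.NumberTheory.EllipticCurves.HaberlandFormulaProofs
import HarnessLib

/-!
# Stokes' theorem on `Γ₀(N)∖ℍ` for the form `Φ f dz`: `∫_{Γ₀(N)∖ℍ} y² f ∂Φ/∂z̄ dμ = 0`

Theorems only (no definitions, no named facts). First analytic brick of the proof of **Riemann's
period relations for `X₀(N)`** in Petersson form (the hypothesis `hRB` of
`PastenSpectralDegreeHomologyProofs.lean`: integrality of the intersection pairing on
`H₁(X₀(N), ℤ) ⊆ S₂(Γ₀(N))^∨`; Farkas–Kra III.1.1), following the construction of the closed dual
form `η_c` of a cycle (Farkas–Kra II.3.3) and the orthogonality `∬ df ∧ η = 0` (Farkas–Kra,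
proof of Prop. III.1.1, and Prop. II.3.2). On the quotient `Γ₀(N)∖ℍ` the latter is Stokes' theorem
for an invariant `1`-form; here it is proved for the forms `Φ · f dz` — `Φ` a bounded `Γ₀(N)`-invariant
real-`C¹` function with `‖DΦ(z)‖ ≤ M'/im z` and `f ∈ S₂(Γ₀(N))` — by the method of
Kohnen–Zagier (p. 243) and Paşol–Popa (§8.2, proof of Thm. 8.6): Green's theorem on the standard
fundamental domain `𝒟` of `SL₂(ℤ)` applied to the coset sum `P = ∑_q (f ∣ g_q⁻¹)(Φ ∘ g_q⁻¹)`,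
whose boundary terms cancel ("the integrals over the vertical sides cancel" by `T`, the arc by
`S`):

* `QuotientStokes.green_dz` — Green's theorem for the form `P dz` on a vertically simple region
  (`∫∫ (i∂P/∂x - ∂P/∂y) = ∮ P dz`; the `dz̄`-version is the tree's `green_dzbar`);
* `QuotientStokes.levelOne_stokes` — for `P` real-`C¹` on the upper half-plane with exponential
  decay on `[-½, ½] × [½, ∞)`, `P(z+1) = P(z)` and `P(-1/z) = z² P(z)`:
  `∫_{-½}^{½} ∫_{√(1-x²)}^∞ (i∂P/∂x - ∂P/∂y) = 0` (the two vertical sides cancel, and the arc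
  integrand `P(ζ(x))ζ'(x)` is odd since `ζ(-x) = S ζ(x)`);
* `QuotientStokes.cosetSum_T_smul`, `cosetSum_S_smul` — `SL₂(ℤ)`-invariance (weight `2`) of the
  coset sum `K(τ) = ∑_q (f ∣ g_q⁻¹)(τ) Φ(g_q⁻¹τ)` (re-indexing by `HaberlandAlgebra.sum_rep_inv_mul`);
* `QuotientStokes.hasFDerivAt_term`, `exists_bound_term` — real derivative
  `D((f∣A)·(Φ∘A)) = a • id + b • conj` of one coset term, with
  `b = (f∣A) · ½(DΦ(Az)1 + iDΦ(Az)i) · \overline{A'(z)}` (the `∂/∂z̄`-part), and exponential decay of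
  the term and of `a, b` at `i∞` (cusp-function bounds `HaberlandStokes.exists_norm_apply_le`,
  `exists_norm_deriv_le`);
* **`QuotientStokes.setIntegral_fd_cosetSum_dbar_eq_zero`** — the result:
  `∫_𝒟 ∑_q [y² f (DΦ 1 + i DΦ i)](g_q⁻¹ τ) dμ(τ) = 0`, i.e. `∫_{Γ₀(N)∖ℍ} y² f ∂Φ/∂z̄ dμ = 0`
  (`DΦ 1 + i DΦ i = 2∂Φ/∂z̄`; the integral over `Γ₀(N)∖ℍ` written, as the tree's
  `peterssonProduct`, on `𝒟` through coset representatives `g_q`,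
  `ModularDegreeFormulaDomainProofs.exists_mapGL_eq_out`).

## References

* [FarkasKra1992] H. M. Farkas, I. Kra, *Riemann Surfaces*, 2nd ed., GTM 71 (1992): II.3.2,
  II.3.3, III.1.1.
* [KohnenZagier1984] W. Kohnen, D. Zagier, *Modular forms with rational periods* (1984): p. 243
  (Stokes' theorem on the fundamental domain).
* [PasolPopa2013] V. Paşol, A. A. Popa, Proc. LMS 107 (2013): §8.2 (proof of Thm. 8.6: the
  vertical sides cancel by `T`, the arc by `z → Sz`).
-/

noncomputable section

open MeasureTheory Set Filter Topology Complex
open scoped ComplexConjugate UpperHalfPlane MatrixGroups ModularForm Modular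

namespace Literature.NumberTheory.EllipticCurves.ModularForms

namespace QuotientStokes

open GreenUHP

/-! ### Green's theorem for the form `P dz` -/

section Green

variable {P : ℂ → ℂ} {P' : ℂ → (ℂ →L[ℝ] ℂ)} {φ φ' : ℝ → ℝ} {a b m C c : ℝ}

/-- **Green's theorem for the form `P dz` on `𝔇 = {a ≤ x ≤ b, y ≥ φ(x)}`** (`P` real-`C¹` on the
upper half-plane, `‖P‖, ‖DP‖ ≤ Ce^{-cy}` on `[a,b] × [m,∞)`, `φ ≥ m > 0` of class `C¹`):
`∫_a^b ∫_{φ(x)}^∞ (i ∂P/∂x - ∂P/∂y)(x + it) dt dx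
   = ∫_a^b P(x + iφ(x)) (1 + iφ'(x)) dx + i∫_{φ(b)}^∞ P(b + it) dt - i∫_{φ(a)}^∞ P(a + it) dt`,
i.e. `-∫_𝔇 d(P dz) = ∮_{∂𝔇} P dz` up to the orientation conventions of the tree's `green_dzbar`
(bottom curve left to right, right side up, left side down; `i∂P/∂x - ∂P/∂y = 2i ∂P/∂z̄`). From the
tree's fibrewise lemmas `integral_setIntegral_Ioi_fderiv_one_eq`, `integral_setIntegral_Ioi_fderiv_I_eq`.
[cite: PasolPopa2013, §8.2 (proof of Thm. 8.6)] -/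
theorem green_dz (hP : ∀ z : ℂ, 0 < z.im → HasFDerivAt P (P' z) z)
    (hP' : ContinuousOn P' {z : ℂ | 0 < z.im})
    (hbP : ∀ z : ℂ, z.re ∈ Icc a b → m ≤ z.im → ‖P z‖ ≤ C * Real.exp (-c * z.im))
    (hbP' : ∀ z : ℂ, z.re ∈ Icc a b → m ≤ z.im → ‖P' z‖ ≤ C * Real.exp (-c * z.im)) (hC : 0 ≤ C)
    (hm : 0 < m) (hc : 0 < c) (hab : a ≤ b) (hφ : ∀ x ∈ Icc a b, HasDerivAt φ (φ' x) x)
    (hφ' : ContinuousOn φ' (Icc a b)) (hφm : ∀ x ∈ Icc a b, m ≤ φ x) :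
    ∫ x in a..b, ∫ t in Ioi (φ x), (I * P' ((x : ℂ) + t * I) 1 - P' ((x : ℂ) + t * I) I) =
      (∫ x in a..b, P ((x : ℂ) + φ x * I) * (1 + (φ' x : ℂ) * I)) +
        I * (∫ t in Ioi (φ b), P ((b : ℂ) + t * I)) - I * (∫ t in Ioi (φ a), P ((a : ℂ) + t * I)) := by
  have hφc : ContinuousOn φ (Icc a b) := fun x hx ↦ (hφ x hx).continuousAt.continuousWithinAt
  have hinner : ∀ x ∈ Icc a b,
      ∫ t in Ioi (φ x), (I * P' ((x : ℂ) + t * I) 1 - P' ((x : ℂ) + t * I) I) =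
        I * (∫ t in Ioi (φ x), P' ((x : ℂ) + t * I) 1) - ∫ t in Ioi (φ x), P' ((x : ℂ) + t * I) I := by
    intro x hx
    have h1 := integrableOn_vertical_fderiv hP' hbP' hm hc hx (hφm x hx) 1
    have hI := integrableOn_vertical_fderiv hP' hbP' hm hc hx (hφm x hx) I
    rw [integral_sub (h1.const_mul I) hI, integral_const_mul]
  rw [intervalIntegral.integral_congr (fun x hx ↦ hinner x (by rwa [uIcc_of_le hab] at hx))]
  have hJ1 := continuousOn_setIntegral_Ioi_moving_fderiv hP' hbP' hC hm hc hφ hφm (1 : ℂ)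
  have hJI := continuousOn_setIntegral_Ioi_moving_fderiv hP' hbP' hC hm hc hφ hφm I
  rw [intervalIntegral.integral_sub ((hJ1.intervalIntegrable_of_Icc hab).const_mul I)
    (hJI.intervalIntegrable_of_Icc hab), intervalIntegral.integral_const_mul,
    integral_setIntegral_Ioi_fderiv_one_eq hP hP' hbP hbP' hC hm hc hab hφ hφ' hφm,
    integral_setIntegral_Ioi_fderiv_I_eq hP hP' hbP hbP' hm hc hab hφm]
  have hPbc : ContinuousOn (fun x : ℝ ↦ P ((x : ℂ) + φ x * I)) (Icc a b) := by
    have hpath : ContinuousOn (fun x : ℝ ↦ (x : ℂ) + φ x * I) (Icc a b) := by fun_prop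
    have hmaps : MapsTo (fun x : ℝ ↦ (x : ℂ) + φ x * I) (Icc a b) {z : ℂ | 0 < z.im} := by
      intro x hx
      simp only [mem_setOf_eq]
      simp
      linarith [hφm x hx]
    have hPc : ContinuousOn P {z : ℂ | 0 < z.im} := fun z hz ↦ (hP z hz).continuousAt.continuousWithinAt
    exact hPc.comp hpath hmaps
  have hBc : ContinuousOn (fun x : ℝ ↦ (φ' x : ℂ) * P ((x : ℂ) + φ x * I)) (Icc a b) :=
    (continuous_ofReal.comp_continuousOn hφ').mul hPbc
  have hsplit : ∫ x in a..b, P ((x : ℂ) + φ x * I) * (1 + (φ' x : ℂ) * I) =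
      (∫ x in a..b, P ((x : ℂ) + φ x * I)) + I * ∫ x in a..b, (φ' x : ℂ) * P ((x : ℂ) + φ x * I) := by
    rw [← intervalIntegral.integral_const_mul, ← intervalIntegral.integral_add
      (hPbc.intervalIntegrable_of_Icc hab) ((hBc.intervalIntegrable_of_Icc hab).const_mul I)]
    refine intervalIntegral.integral_congr fun x _ ↦ ?_
    ring
  rw [hsplit]
  ring

end Green

/-! ### Stokes on the standard fundamental domain for a weight-2 invariant smooth function -/

section LevelOne

variable {P : ℂ → ℂ} {P' : ℂ → (ℂ →L[ℝ] ℂ)} {C c : ℝ}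

/-- The bottom arc `ζ(x) = x + i√(1 - x²)` of `𝒟` lies on the unit circle. [folklore] -/
theorem arc_normSq {x : ℝ} (hx : x ∈ Icc (-(1 / 2) : ℝ) (1 / 2)) :
    Complex.normSq ((x : ℂ) + Real.sqrt (1 - x ^ 2) * I) = 1 := by
  have h1 : 0 ≤ 1 - x ^ 2 := (HaberlandBoundary.one_sub_sq_pos hx).le
  rw [Complex.normSq_apply]
  simp only [Complex.add_re, Complex.ofReal_re, Complex.mul_re, Complex.I_re, mul_zero,
    Complex.ofReal_im, Complex.I_im, mul_one, sub_self, add_zero, Complex.add_im, Complex.mul_im,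
    zero_add]
  nlinarith [Real.mul_self_sqrt h1]

/-- `ζ(-x) = -ζ(x)⁻¹ = S ζ(x)`: the symmetry `x ↦ -x` of the arc is the action of `S` (Paşol–Popa
§8.2: "we change variables `z → Sz`"). [cite: PasolPopa2013, §8.2 (proof of Thm. 8.6)] -/
theorem arc_neg {x : ℝ} (hx : x ∈ Icc (-(1 / 2) : ℝ) (1 / 2)) :
    (((-x : ℝ) : ℂ) + Real.sqrt (1 - (-x) ^ 2) * I) = -((x : ℂ) + Real.sqrt (1 - x ^ 2) * I)⁻¹ := by
  have hn := arc_normSq hx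
  have hne : ((x : ℂ) + Real.sqrt (1 - x ^ 2) * I) ≠ 0 := by
    intro h0; rw [h0, map_zero] at hn; exact zero_ne_one hn
  rw [Complex.inv_def, hn, inv_one, Complex.ofReal_one, mul_one, neg_sq]
  apply Complex.ext <;> simp

/-- **Stokes on the standard fundamental domain for a weight-`2` invariant function.** Let `P` be
real-`C¹` on the upper half-plane with `‖P‖, ‖DP‖ ≤ Ce^{-cy}` on `[-½, ½] × [½, ∞)`, and suppose
`P(z + 1) = P(z)` and `P(-1/z) = z² P(z)` (i.e. `P dz` is `SL₂(ℤ)`-invariant). Then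
`∫_{-½}^{½} ∫_{√(1-x²)}^∞ (i∂P/∂x - ∂P/∂y)(x+it) dt dx = 0` — Green's theorem on
`𝒟 = {|x| ≤ ½, |z| ≥ 1}` (`green_dz`), where the two vertical sides cancel by `T` and the arc integral
`∫_{-½}^{½} P(ζ(x))ζ'(x) dx` vanishes because its integrand is odd (`ζ(-x) = Sζ(x)`,
`ζ'(-x) = -ζ'(x)/ζ(x)²`) — the cancellations of Paşol–Popa §8.2 / Kohnen–Zagier p. 243 for an exactly
invariant form. [cite: PasolPopa2013, §8.2 (proof of Thm. 8.6)] [cite: KohnenZagier1984, p. 243] -/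
theorem levelOne_stokes (hP : ∀ z : ℂ, 0 < z.im → HasFDerivAt P (P' z) z)
    (hP' : ContinuousOn P' {z : ℂ | 0 < z.im})
    (hbP : ∀ z : ℂ, z.re ∈ Icc (-(1 / 2) : ℝ) (1 / 2) → 1 / 2 ≤ z.im → ‖P z‖ ≤ C * Real.exp (-c * z.im))
    (hbP' : ∀ z : ℂ, z.re ∈ Icc (-(1 / 2) : ℝ) (1 / 2) → 1 / 2 ≤ z.im →
      ‖P' z‖ ≤ C * Real.exp (-c * z.im))
    (hC : 0 ≤ C) (hc : 0 < c)
    (hT : ∀ z : ℂ, 0 < z.im → P (z + 1) = P z)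
    (hS : ∀ z : ℂ, 0 < z.im → P (-z⁻¹) = z ^ 2 * P z) :
    ∫ x in (-(1 / 2) : ℝ)..(1 / 2), ∫ t in Ioi (Real.sqrt (1 - x ^ 2)),
      (I * P' ((x : ℂ) + t * I) 1 - P' ((x : ℂ) + t * I) I) = 0 := by
  rw [green_dz (φ := fun x : ℝ ↦ Real.sqrt (1 - x ^ 2)) (φ' := fun x : ℝ ↦ -x / Real.sqrt (1 - x ^ 2))
    (m := 1 / 2) hP hP' hbP hbP' hC one_half_pos hc (by norm_num)
    (fun x hx ↦ HaberlandStokes.hasDerivAt_arc hx) HaberlandStokes.continuousOn_arc_deriv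
    (fun x hx ↦ HaberlandStokes.half_le_arc hx)]
  -- the vertical sides cancel by `T`-invariance
  have hsides : (∫ t in Ioi (Real.sqrt (1 - (1 / 2 : ℝ) ^ 2)), P ((((1 / 2 : ℝ)) : ℂ) + t * I)) =
      ∫ t in Ioi (Real.sqrt (1 - (-(1 / 2) : ℝ) ^ 2)), P ((((-(1 / 2) : ℝ)) : ℂ) + t * I) := by
    rw [neg_sq]
    refine setIntegral_congr_fun measurableSet_Ioi fun t ht ↦ ?_
    have ht0 : 0 < t := by
      have h34 : (0 : ℝ) < Real.sqrt (1 - (1 / 2 : ℝ) ^ 2) := Real.sqrt_pos.mpr (by norm_num)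
      exact h34.trans (mem_Ioi.mp ht)
    have him : 0 < ((((-(1 / 2) : ℝ)) : ℂ) + t * I).im := by simpa using ht0
    have := hT _ him
    rw [← this]
    congr 1
    push_cast
    ring
  -- the arc integral vanishes by `S`-invariance (the integrand is odd)
  have harc : ∫ x in (-(1 / 2) : ℝ)..(1 / 2),
      P ((x : ℂ) + Real.sqrt (1 - x ^ 2) * I) * (1 + ((-x / Real.sqrt (1 - x ^ 2) : ℝ) : ℂ) * I) = 0 := by
    set F : ℝ → ℂ := fun x ↦
      P ((x : ℂ) + Real.sqrt (1 - x ^ 2) * I) * (1 + ((-x / Real.sqrt (1 - x ^ 2) : ℝ) : ℂ) * I) with hF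
    have hodd : ∀ x ∈ Icc (-(1 / 2) : ℝ) (1 / 2), F (-x) = -F x := by
      intro x hx
      have hx' : -x ∈ Icc (-(1 / 2) : ℝ) (1 / 2) := ⟨by linarith [hx.2], by linarith [hx.1]⟩
      have hs0 : (0 : ℝ) < Real.sqrt (1 - x ^ 2) := Real.sqrt_pos.mpr (HaberlandBoundary.one_sub_sq_pos hx)
      set ζ : ℂ := (x : ℂ) + Real.sqrt (1 - x ^ 2) * I with hζ
      have hζn : Complex.normSq ζ = 1 := arc_normSq hx
      have hζ0 : ζ ≠ 0 := by
        intro h0; rw [h0, map_zero] at hζn; exact zero_ne_one hζn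
      have him : 0 < ζ.im := by simpa [hζ] using hs0
      -- `ζ'(x) = -iζ/s`, `ζ(-x) = -ζ⁻¹`
      have hsR : Real.sqrt (1 - x ^ 2) ≠ 0 := hs0.ne'
      have hderiv : (1 + ((-x / Real.sqrt (1 - x ^ 2) : ℝ) : ℂ) * I) =
          -I * ζ / (Real.sqrt (1 - x ^ 2) : ℂ) := by
        rw [hζ]
        apply Complex.ext
        · simp [Complex.div_ofReal_re, div_self hsR]
        · simp [Complex.div_ofReal_im]
      have hderiv' : (1 + ((-(-x) / Real.sqrt (1 - (-x) ^ 2) : ℝ) : ℂ) * I) =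
          I * ζ⁻¹ / (Real.sqrt (1 - x ^ 2) : ℂ) := by
        rw [neg_sq, neg_neg, Complex.inv_def, hζn, inv_one, Complex.ofReal_one, mul_one, hζ]
        apply Complex.ext
        · simp [Complex.div_ofReal_re, div_self hsR]
        · simp [Complex.div_ofReal_im]
      simp only [hF]
      rw [arc_neg hx, ← hζ, hS ζ him, hderiv, hderiv']
      field_simp
    -- `∫_{-1/2}^{1/2} F = ∫_{-1/2}^{1/2} F(-x) = -∫ F`
    have h1 : ∫ x in (-(1 / 2) : ℝ)..(1 / 2), F x = ∫ x in (-(1 / 2) : ℝ)..(1 / 2), F (-x) := by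
      rw [intervalIntegral.integral_comp_neg]
      norm_num
    have h2 : ∫ x in (-(1 / 2) : ℝ)..(1 / 2), F (-x) = -∫ x in (-(1 / 2) : ℝ)..(1 / 2), F x := by
      rw [← intervalIntegral.integral_neg]
      refine intervalIntegral.integral_congr fun x hx ↦ hodd x ?_
      rwa [uIcc_of_le (by norm_num)] at hx
    have h3 := h1.trans h2
    change ∫ x in (-(1 / 2) : ℝ)..(1 / 2), F x = 0
    linear_combination h3 / 2
  rw [harc, hsides]
  ring

end LevelOne


/-! ### Real-linear maps on `ℂ`: the decomposition `L = α • id + β • conj` -/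

section CLM

/-- `L h = (re h) L(1) + (im h) L(i)` for a real-linear `L : ℂ → ℂ`. [folklore] -/
theorem clm_apply_re_im (L : ℂ →L[ℝ] ℂ) (h : ℂ) :
    L h = (h.re : ℂ) * L 1 + (h.im : ℂ) * L I := by
  conv_lhs => rw [← Complex.re_add_im h]
  rw [map_add]
  have h1 : L (h.re : ℂ) = (h.re : ℂ) * L 1 := by
    have e := L.map_smul h.re (1 : ℂ)
    rw [Complex.real_smul, Complex.real_smul, mul_one] at e
    exact e
  have h2 : L ((h.im : ℂ) * I) = (h.im : ℂ) * L I := by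
    have e := L.map_smul h.im I
    rw [Complex.real_smul, Complex.real_smul] at e
    exact e
  rw [h1, h2]

/-- **Every real-linear self-map of `ℂ` is `h ↦ α h + β h̄`** with `α = (L1 - iL(i))/2` (the
`∂/∂z`-part) and `β = (L1 + iL(i))/2` (the `∂/∂z̄`-part). [folklore] -/
theorem clm_eq_smul_id_add_smul_conj (L : ℂ →L[ℝ] ℂ) :
    L = ((L 1 - I * L I) / 2) • ContinuousLinearMap.id ℝ ℂ +
      ((L 1 + I * L I) / 2) • (conjCLE : ℂ →L[ℝ] ℂ) := by
  refine ContinuousLinearMap.ext fun h ↦ ?_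
  rw [HaberlandStokes.clm_apply, clm_apply_re_im L h]
  conv_rhs => rw [← Complex.re_add_im h]
  simp only [map_add, map_mul, Complex.conj_ofReal, Complex.conj_I]
  ring_nf
  rw [Complex.I_sq]
  ring

/-- The Stokes integrand of `P dz` for `DP = a • id + b • conj`: `i DP(1) - DP(i) = 2i b`
(`= 2i ∂P/∂z̄`). [folklore] -/
theorem stokes_integrand_clm (a b : ℂ) :
    I * (a • ContinuousLinearMap.id ℝ ℂ + b • (conjCLE : ℂ →L[ℝ] ℂ)) 1 -
      (a • ContinuousLinearMap.id ℝ ℂ + b • (conjCLE : ℂ →L[ℝ] ℂ)) I = 2 * I * b := by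
  rw [HaberlandStokes.clm_apply, HaberlandStokes.clm_apply, map_one, Complex.conj_I]
  ring

/-- Norm bound for the two parts: `‖(L1 ∓ iL(i))/2‖ ≤ ‖L‖`. [folklore] -/
theorem norm_half_parts_le (L : ℂ →L[ℝ] ℂ) :
    ‖(L 1 - I * L I) / 2‖ ≤ ‖L‖ ∧ ‖(L 1 + I * L I) / 2‖ ≤ ‖L‖ := by
  have h1 : ‖L 1‖ ≤ ‖L‖ := by simpa using L.le_opNorm 1
  have hI : ‖I * L I‖ ≤ ‖L‖ := by
    rw [norm_mul, Complex.norm_I, one_mul]; simpa using L.le_opNorm I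
  constructor
  · rw [norm_div, Complex.norm_two]
    have := norm_sub_le (L 1) (I * L I)
    linarith
  · rw [norm_div, Complex.norm_two]
    have := norm_add_le (L 1) (I * L I)
    linarith

end CLM

/-! ### The coset sum `P = ∑_q (f ∣ g_q⁻¹) · (Φ ∘ g_q⁻¹)` and its `SL(2, ℤ)`-invariance -/

section CosetSum

open UpperHalfPlane hiding I
open ModularGroup CongruenceSubgroup

variable {N : ℕ} (g : (↥𝒮ℒ ⧸ (Gamma0 N : Subgroup (GL (Fin 2) ℝ)).subgroupOf 𝒮ℒ) → SL(2, ℤ))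
  (hg : ∀ q, (Matrix.SpecialLinearGroup.mapGL ℝ (g q) : GL (Fin 2) ℝ) = ((q.out : ↥𝒮ℒ) : GL (Fin 2) ℝ))

/-- `moebius T z = z + 1`. [folklore] -/
theorem moebius_T (z : ℂ) : moebius T z = z + 1 := by
  simp [moebius, coe_T]

/-- `moebius S z = -z⁻¹`. [folklore] -/
theorem moebius_S (z : ℂ) : moebius S z = -z⁻¹ := by
  simp [moebius, coe_S, neg_div]

/-- `f ∣ γ = f` for `γ ∈ Γ₀(N)` and a cusp form `f` of any weight. [folklore] -/
theorem slash_eq_self_of_mem {k : ℤ} (f : CuspForm (Gamma0 N) k) {γ : SL(2, ℤ)} (hγ : γ ∈ Gamma0 N) :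
    ⇑f ∣[k] γ = ⇑f := by
  rw [ModularForm.SL_slash]
  exact SlashInvariantForm.slash_action_eqn f _
    (Subgroup.mem_map_of_mem (Matrix.SpecialLinearGroup.mapGL ℝ) hγ)

variable [Fintype (↥𝒮ℒ ⧸ (Gamma0 N : Subgroup (GL (Fin 2) ℝ)).subgroupOf 𝒮ℒ)]

include hg in
/-- **`T`-invariance of the coset sum**: for `Φ` invariant under `Γ₀(N)` and `f ∈ S₂(Γ₀(N))`,
`K(Tτ) = K(τ)` where `K(τ) = ∑_q (f ∣ g_q⁻¹)(τ) Φ(g_q⁻¹ τ)` (`g_q⁻¹ T = γ_q g_{q'}⁻¹`, a permutation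
of the cosets; Paşol–Popa §8.2, "`F_{AT}(z) = F_A(Tz)`"). [cite: PasolPopa2013, §8.2 (proof of Thm. 8.6)] -/
theorem cosetSum_T_smul (f : CuspForm (Gamma0 N) 2) {Φ : ℍ → ℂ}
    (hinv : ∀ γ : SL(2, ℤ), γ ∈ Gamma0 N → ∀ τ : ℍ, Φ (γ • τ) = Φ τ) (τ : ℍ) :
    ∑ q, (⇑f ∣[(2 : ℤ)] (g q)⁻¹) (T • τ) * Φ ((g q)⁻¹ • T • τ) =
      ∑ q, (⇑f ∣[(2 : ℤ)] (g q)⁻¹) τ * Φ ((g q)⁻¹ • τ) := by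
  have h := HaberlandAlgebra.sum_rep_inv_mul g hg
    (fun B : SL(2, ℤ) ↦ (⇑f ∣[(2 : ℤ)] B) τ * Φ (B • τ)) (fun γ hγ B ↦ by
      simp only [SlashAction.slash_mul, slash_eq_self_of_mem f hγ, mul_smul, hinv γ hγ]) T
  rw [← h]
  refine Finset.sum_congr rfl fun q _ ↦ ?_
  rw [HaberlandBoundary.slash_apply_T_smul, mul_smul]

include hg in
/-- **`S`-invariance of the coset sum** (weight `2`): `K(Sτ) = τ² K(τ)`. [cite: PasolPopa2013, §8.2 (proof of Thm. 8.6)] -/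
theorem cosetSum_S_smul (f : CuspForm (Gamma0 N) 2) {Φ : ℍ → ℂ}
    (hinv : ∀ γ : SL(2, ℤ), γ ∈ Gamma0 N → ∀ τ : ℍ, Φ (γ • τ) = Φ τ) (τ : ℍ) :
    ∑ q, (⇑f ∣[(2 : ℤ)] (g q)⁻¹) (S • τ) * Φ ((g q)⁻¹ • S • τ) =
      (τ : ℂ) ^ 2 * ∑ q, (⇑f ∣[(2 : ℤ)] (g q)⁻¹) τ * Φ ((g q)⁻¹ • τ) := by
  have h := HaberlandAlgebra.sum_rep_inv_mul g hg
    (fun B : SL(2, ℤ) ↦ (⇑f ∣[(2 : ℤ)] B) τ * Φ (B • τ)) (fun γ hγ B ↦ by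
      simp only [SlashAction.slash_mul, slash_eq_self_of_mem f hγ, mul_smul, hinv γ hγ]) S
  rw [← h, Finset.mul_sum]
  refine Finset.sum_congr rfl fun q _ ↦ ?_
  rw [HaberlandBoundary.slash_apply_S_smul, mul_smul]
  simp only [zpow_two, pow_two]
  ring

end CosetSum

/-! ### One coset term `u · v`, `u = (f ∣ A) ∘ ofComplex`, `v = Φ ∘ A`: derivative and continuity -/

section Term

open UpperHalfPlane hiding I
open ModularGroup CongruenceSubgroup

variable {N : ℕ} [NeZero N]

/-- **Real derivative of one coset term** `u · v`, `u = (f ∣ A) ∘ ofComplex` (holomorphic, a cusp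
function), `v = Φ ∘ A` (`Φ` real-`C¹`): `D(uv)(z) = a • id + b • conj` with
`a = u · ½(DΦ(Az)1 - iDΦ(Az)i) · A'(z) + v · u'` (the `∂/∂z`-part) and
`b = u · ½(DΦ(Az)1 + iDΦ(Az)i) · \overline{A'(z)}` (the `∂/∂z̄`-part: `∂(Φ∘A)/∂z̄ = (∂Φ/∂z̄)(Az) \overline{A'}`),
by the product and chain rules (`hasDerivAt_moebius`, `HaberlandStokes.hasDerivAt_comp_ofComplex`).
[folklore] -/
theorem hasFDerivAt_term (f : CuspForm (Gamma0 N) 2) (A : SL(2, ℤ)) {Φ : ℍ → ℂ}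
    {Φ' : ℂ → (ℂ →L[ℝ] ℂ)} (hΦ : ∀ z : ℂ, 0 < z.im → HasFDerivAt (Φ ∘ ofComplex) (Φ' z) z)
    {z : ℂ} (hz : 0 < z.im) :
    HasFDerivAt (fun w ↦ ((⇑f ∣[(2 : ℤ)] A) ∘ ofComplex) w * (Φ ∘ ofComplex) (moebius A w))
      ((((⇑f ∣[(2 : ℤ)] A) ∘ ofComplex) z *
          ((Φ' (moebius A z) 1 - I * Φ' (moebius A z) I) / 2) *
            (1 / (((A 1 0 : ℤ) : ℂ) * z + ((A 1 1 : ℤ) : ℂ)) ^ 2) +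
          (Φ ∘ ofComplex) (moebius A z) * deriv ((⇑f ∣[(2 : ℤ)] A) ∘ ofComplex) z) •
          ContinuousLinearMap.id ℝ ℂ +
        (((⇑f ∣[(2 : ℤ)] A) ∘ ofComplex) z *
          ((Φ' (moebius A z) 1 + I * Φ' (moebius A z) I) / 2) *
            conj (1 / (((A 1 0 : ℤ) : ℂ) * z + ((A 1 1 : ℤ) : ℂ)) ^ 2)) •
          (conjCLE : ℂ →L[ℝ] ℂ)) z := by
  set u : ℂ → ℂ := (⇑f ∣[(2 : ℤ)] A) ∘ ofComplex with hu
  set L := Φ' (moebius A z) with hL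
  set d : ℂ := 1 / (((A 1 0 : ℤ) : ℂ) * z + ((A 1 1 : ℤ) : ℂ)) ^ 2 with hd
  have hcf : IsCuspFunction N (⇑f ∣[(2 : ℤ)] A) := isCuspFunction_slash f A
  have hu' : HasFDerivAt u ((ContinuousLinearMap.toSpanSingleton ℂ (deriv u z)).restrictScalars ℝ) z :=
    (HaberlandStokes.hasDerivAt_comp_ofComplex hcf hz).hasFDerivAt.restrictScalars ℝ
  have hmo : HasFDerivAt (moebius A) ((ContinuousLinearMap.toSpanSingleton ℂ d).restrictScalars ℝ) z :=
    (hasDerivAt_moebius A hz).hasFDerivAt.restrictScalars ℝ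
  have hv : HasFDerivAt (fun w ↦ (Φ ∘ ofComplex) (moebius A w))
      (L.comp ((ContinuousLinearMap.toSpanSingleton ℂ d).restrictScalars ℝ)) z :=
    (hΦ _ (moebius_im_pos A hz)).comp z hmo
  have H := hu'.mul hv
  refine H.congr_fderiv (ContinuousLinearMap.ext fun h ↦ ?_)
  have hLw : ∀ w : ℂ, L w = (L 1 - I * L I) / 2 * w + (L 1 + I * L I) / 2 * conj w := fun w ↦ by
    conv_lhs => rw [clm_eq_smul_id_add_smul_conj L]
    rw [HaberlandStokes.clm_apply]
  have hc : (conjCLE : ℂ →L[ℝ] ℂ) h = conj h := by simp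
  simp only [add_apply, smul_apply,
    ContinuousLinearMap.coe_comp, Function.comp_apply, ContinuousLinearMap.coe_restrictScalars',
    ContinuousLinearMap.toSpanSingleton_apply, smul_eq_mul, ContinuousLinearMap.id_apply, hc]
  rw [hLw (h * d), map_mul]
  ring

/-- Möbius transformations are continuous on the upper half-plane. [folklore] -/
theorem continuousOn_moebius (A : SL(2, ℤ)) : ContinuousOn (moebius A) {z : ℂ | 0 < z.im} :=
  fun _ hz ↦ (hasDerivAt_moebius A hz).continuousAt.continuousWithinAt

/-- Möbius transformations of `SL(2, ℤ)` preserve the upper half-plane. [folklore] -/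
theorem mapsTo_moebius (A : SL(2, ℤ)) : MapsTo (moebius A) {z : ℂ | 0 < z.im} {z : ℂ | 0 < z.im} :=
  fun _ hz ↦ moebius_im_pos A hz


/-- `im (Az) = im z / |cz + d|²`. [folklore] -/
theorem im_moebius_eq (A : SL(2, ℤ)) {z : ℂ} (hz : 0 < z.im) :
    (moebius A z).im = z.im / Complex.normSq (((A 1 0 : ℤ) : ℂ) * z + ((A 1 1 : ℤ) : ℂ)) := by
  rw [← coe_smul_ofComplex A hz, UpperHalfPlane.coe_im, ModularGroup.im_smul_eq_div_normSq,
    denom_ofComplex A hz, UpperHalfPlane.ofComplex_apply_of_im_pos hz]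
  rfl

/-- `|A'(z)| = |cz + d|⁻² = im(Az) / im z`. [folklore] -/
theorem norm_inv_denom_sq (A : SL(2, ℤ)) {z : ℂ} (hz : 0 < z.im) :
    ‖(1 : ℂ) / (((A 1 0 : ℤ) : ℂ) * z + ((A 1 1 : ℤ) : ℂ)) ^ 2‖ =
      (moebius A z).im / z.im := by
  rw [im_moebius_eq A hz, norm_div, norm_one, norm_pow, Complex.normSq_eq_norm_sq]
  have hz0 : z.im ≠ 0 := hz.ne'
  field_simp

/-- **Bounds for one coset term at height `≥ 2`.** With `u = (f ∣ A) ∘ ofComplex`, `v = Φ ∘ A`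
and the derivative parts `a, b` of `hasFDerivAt_term`: `‖u v‖, ‖a‖, ‖b‖ ≤ C e^{-2πy/N}` for
`im z ≥ 2`, provided `‖Φ‖ ≤ M` and `‖DΦ(w)‖ ≤ M'/im w` (so that `‖DΦ(Az)‖ |A'(z)| ≤ M'/im z`), from
the exponential decay of the cusp function `f ∣ A` and of its derivative
(`HaberlandStokes.exists_norm_apply_le`, `exists_norm_deriv_le`). [folklore] -/
theorem exists_bound_term (f : CuspForm (Gamma0 N) 2) (A : SL(2, ℤ)) {Φ : ℍ → ℂ}
    {Φ' : ℂ → (ℂ →L[ℝ] ℂ)} {M M' : ℝ} (hM0 : 0 ≤ M) (hM'0 : 0 ≤ M')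
    (hM : ∀ τ : ℍ, ‖Φ τ‖ ≤ M) (hM' : ∀ z : ℂ, 0 < z.im → ‖Φ' z‖ ≤ M' / z.im) :
    ∃ C : ℝ, 0 ≤ C ∧ ∀ z : ℂ, 2 ≤ z.im →
      ‖((⇑f ∣[(2 : ℤ)] A) ∘ ofComplex) z * (Φ ∘ ofComplex) (moebius A z)‖ ≤
          C * Real.exp (-(2 * Real.pi / N) * z.im) ∧
      ‖((⇑f ∣[(2 : ℤ)] A) ∘ ofComplex) z *
            ((Φ' (moebius A z) 1 - I * Φ' (moebius A z) I) / 2) *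
            (1 / (((A 1 0 : ℤ) : ℂ) * z + ((A 1 1 : ℤ) : ℂ)) ^ 2) +
          (Φ ∘ ofComplex) (moebius A z) * deriv ((⇑f ∣[(2 : ℤ)] A) ∘ ofComplex) z‖ ≤
          C * Real.exp (-(2 * Real.pi / N) * z.im) ∧
      ‖((⇑f ∣[(2 : ℤ)] A) ∘ ofComplex) z *
            ((Φ' (moebius A z) 1 + I * Φ' (moebius A z) I) / 2) *
            conj (1 / (((A 1 0 : ℤ) : ℂ) * z + ((A 1 1 : ℤ) : ℂ)) ^ 2)‖ ≤
          C * Real.exp (-(2 * Real.pi / N) * z.im) := by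
  have hcf : IsCuspFunction N (⇑f ∣[(2 : ℤ)] A) := isCuspFunction_slash f A
  obtain ⟨C₁, hC₁, hb₁⟩ := HaberlandStokes.exists_norm_apply_le hcf
  obtain ⟨C₂, hC₂, hb₂⟩ := HaberlandStokes.exists_norm_deriv_le hcf
  refine ⟨C₁ * M + C₁ * M' + M * C₂, by positivity, fun z hz ↦ ?_⟩
  have hz0 : 0 < z.im := by linarith
  set e := Real.exp (-(2 * Real.pi / N) * z.im) with he
  have he0 : 0 < e := Real.exp_pos _
  set w := moebius A z with hw
  have hw0 : 0 < w.im := moebius_im_pos A hz0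
  have hu : ‖((⇑f ∣[(2 : ℤ)] A) ∘ ofComplex) z‖ ≤ C₁ * e := hb₁ z (by linarith)
  have hv : ‖(Φ ∘ ofComplex) w‖ ≤ M := hM _
  have hu' : ‖deriv ((⇑f ∣[(2 : ℤ)] A) ∘ ofComplex) z‖ ≤ C₂ * e := hb₂ z hz
  have hL : ‖Φ' w‖ ≤ M' / w.im := hM' w hw0
  have hparts := norm_half_parts_le (Φ' w)
  have hd : ‖(1 : ℂ) / (((A 1 0 : ℤ) : ℂ) * z + ((A 1 1 : ℤ) : ℂ)) ^ 2‖ = w.im / z.im :=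
    norm_inv_denom_sq A hz0
  -- `‖α‖ ‖d‖, ‖β‖ ‖d‖ ≤ M'/ im z ≤ M'`
  have hkey : ∀ p : ℂ, ‖p‖ ≤ ‖Φ' w‖ →
      ‖p‖ * ‖(1 : ℂ) / (((A 1 0 : ℤ) : ℂ) * z + ((A 1 1 : ℤ) : ℂ)) ^ 2‖ ≤ M' := by
    intro p hp
    rw [hd]
    have h1 : ‖p‖ * (w.im / z.im) ≤ M' / w.im * (w.im / z.im) :=
      mul_le_mul_of_nonneg_right (hp.trans hL) (by positivity)
    have h2 : M' / w.im * (w.im / z.im) = M' / z.im := by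
      field_simp
    rw [h2] at h1
    have h3 : M' / z.im ≤ M' := by
      rw [div_le_iff₀ hz0]
      nlinarith
    exact h1.trans h3
  have hn1 : 0 ≤ C₁ * M * e := by positivity
  have hn2 : 0 ≤ C₁ * M' * e := by positivity
  have hn3 : 0 ≤ M * C₂ * e := by positivity
  refine ⟨?_, ?_, ?_⟩
  · rw [norm_mul]
    have h := mul_le_mul hu hv (norm_nonneg _) (by positivity)
    linarith
  · refine (norm_add_le _ _).trans ?_
    rw [norm_mul, norm_mul, norm_mul]
    have h1 : ‖((⇑f ∣[(2 : ℤ)] A) ∘ ofComplex) z‖ * ‖(Φ' w 1 - I * Φ' w I) / 2‖ *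
        ‖(1 : ℂ) / (((A 1 0 : ℤ) : ℂ) * z + ((A 1 1 : ℤ) : ℂ)) ^ 2‖ ≤ C₁ * e * M' := by
      rw [mul_assoc]
      exact mul_le_mul hu (hkey _ hparts.1) (by positivity) (by positivity)
    have h2 : ‖(Φ ∘ ofComplex) w‖ * ‖deriv ((⇑f ∣[(2 : ℤ)] A) ∘ ofComplex) z‖ ≤ M * (C₂ * e) :=
      mul_le_mul hv hu' (norm_nonneg _) hM0
    linarith
  · rw [norm_mul, norm_mul, Complex.norm_conj]
    have h1 : ‖((⇑f ∣[(2 : ℤ)] A) ∘ ofComplex) z‖ * ‖(Φ' w 1 + I * Φ' w I) / 2‖ *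
        ‖(1 : ℂ) / (((A 1 0 : ℤ) : ℂ) * z + ((A 1 1 : ℤ) : ℂ)) ^ 2‖ ≤ C₁ * e * M' := by
      rw [mul_assoc]
      exact mul_le_mul hu (hkey _ hparts.2) (by positivity) (by positivity)
    linarith


omit [NeZero N] in
/-- `(f∣A)(z) · \overline{A'(z)} = f(Az) |A'(z)|² = f(Az) (im Az)² / (im z)²` (weight `2`). [folklore] -/
theorem slash_mul_conj_inv_denom_sq (f : CuspForm (Gamma0 N) 2) (A : SL(2, ℤ)) {z : ℂ} (hz : 0 < z.im) :
    ((⇑f ∣[(2 : ℤ)] A) ∘ ofComplex) z * conj ((1 : ℂ) / (((A 1 0 : ℤ) : ℂ) * z + ((A 1 1 : ℤ) : ℂ)) ^ 2) =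
      ((1 / z.im ^ 2 : ℝ) : ℂ) *
        (((((A • ofComplex z : ℍ)).im : ℝ) : ℂ) ^ 2 * f (A • ofComplex z)) := by
  set w : ℂ := ((A 1 0 : ℤ) : ℂ) * z + ((A 1 1 : ℤ) : ℂ) with hw
  have hw0 : w ≠ 0 := moebius_denom_ne_zero A hz
  have hcw0 : conj w ≠ 0 := (map_ne_zero _).mpr hw0
  have hzi : (z.im : ℂ) ≠ 0 := Complex.ofReal_ne_zero.mpr hz.ne'
  have him : ((A • ofComplex z : ℍ)).im = z.im / Complex.normSq w := by
    rw [ModularGroup.im_smul_eq_div_normSq, denom_ofComplex A hz,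
      UpperHalfPlane.ofComplex_apply_of_im_pos hz]
    rfl
  rw [Function.comp_apply, ModularForm.SL_slash_apply, denom_ofComplex A hz, ← hw, him]
  have hn : ((Complex.normSq w : ℝ) : ℂ) = conj w * w := Complex.normSq_eq_conj_mul_self
  push_cast
  rw [hn, map_div₀, map_one, map_pow, zpow_neg, zpow_ofNat]
  field_simp

variable (g : (↥𝒮ℒ ⧸ (Gamma0 N : Subgroup (GL (Fin 2) ℝ)).subgroupOf 𝒮ℒ) → SL(2, ℤ))
  (hg : ∀ q, (Matrix.SpecialLinearGroup.mapGL ℝ (g q) : GL (Fin 2) ℝ) = ((q.out : ↥𝒮ℒ) : GL (Fin 2) ℝ))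
  [Fintype (↥𝒮ℒ ⧸ (Gamma0 N : Subgroup (GL (Fin 2) ℝ)).subgroupOf 𝒮ℒ)]

include hg in
/-- **Stokes' theorem on `Γ₀(N)∖ℍ` for the form `Φ f dz`: `∫_{Γ₀(N)∖ℍ} y² f ∂Φ/∂z̄ dμ = 0`.**
Let `f ∈ S₂(Γ₀(N))`, and let `Φ : ℍ → ℂ` be `Γ₀(N)`-invariant, real-`C¹` (`D(Φ ∘ ofComplex)(z) = DΦ(z)`
with `DΦ` continuous on the upper half-plane), bounded (`‖Φ‖ ≤ M`) with `‖DΦ(z)‖ ≤ M'/im z`. Then,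
for any system `g_q` of coset representatives of `Γ₀(N)` in `SL₂(ℤ)`,
`∫_𝒟 ∑_q [(im σ)² f(σ) (DΦ(σ)1 + i DΦ(σ)i)]_{σ = g_q⁻¹τ} dμ(τ) = 0`
(`DΦ 1 + i DΦ i = 2 ∂Φ/∂z̄`; the left side is `2 ∫_{Γ₀(N)∖ℍ} y² f ∂Φ/∂z̄ dμ = -i ∫_{X₀(N)} d(Φ f dz)`
written on `𝒟` through the cosets, as the tree's `peterssonProduct`). Proof: the coset sum
`P = ∑_q (f ∣ g_q⁻¹)(Φ ∘ g_q⁻¹)` on `ℂ` is real-`C¹` with `DP = a • id + b • conj`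
(`hasFDerivAt_term`), decays exponentially with its derivative on `[-½,½] × [½,∞)`
(`exists_bound_term`, `HaberlandStokes.exists_bound_of_bound_ge`), and satisfies `P(z+1) = P(z)`,
`P(-1/z) = z²P(z)` (`cosetSum_T_smul`, `cosetSum_S_smul`); so `levelOne_stokes` gives
`∫∫ 2i b = 0`, and `2i b(z) = (i/y²) ∑_q [(im σ)² f (DΦ1 + iDΦi)](g_q⁻¹ τ)`
(`slash_mul_conj_inv_denom_sq`), whence the claim by `FdCoord.setIntegral_fd_eq_intervalIntegral`
(the integrand is bounded, `CuspFormClass.exists_bound`, and continuous on `𝒟` of finite volume).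
This is the orthogonality `∬_M df ∧ η = 0` of Farkas–Kra (proof of Prop. III.1.1; Prop. II.3.2) on
`M = X₀(N)` for `η = f dz`, obtained as in Kohnen–Zagier p. 243 / Paşol–Popa §8.2.
[cite: FarkasKra1992, III.1.1 (proof) and II.3.2] [cite: PasolPopa2013, §8.2 (proof of Thm. 8.6)]
[cite: KohnenZagier1984, p. 243] -/
theorem setIntegral_fd_cosetSum_dbar_eq_zero (f : CuspForm (Gamma0 N) 2) {Φ : ℍ → ℂ}
    {Φ' : ℂ → (ℂ →L[ℝ] ℂ)} {M M' : ℝ}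
    (hΦ : ∀ z : ℂ, 0 < z.im → HasFDerivAt (Φ ∘ ofComplex) (Φ' z) z)
    (hΦ'c : ContinuousOn Φ' {z : ℂ | 0 < z.im})
    (hinv : ∀ γ : SL(2, ℤ), γ ∈ Gamma0 N → ∀ τ : ℍ, Φ (γ • τ) = Φ τ)
    (hM : ∀ τ : ℍ, ‖Φ τ‖ ≤ M) (hM' : ∀ z : ℂ, 0 < z.im → ‖Φ' z‖ ≤ M' / z.im) :
    ∫ τ in 𝒟, ∑ q, ((((((g q)⁻¹ • τ : ℍ)).im : ℝ) : ℂ) ^ 2 * f ((g q)⁻¹ • τ) *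
      (Φ' ((((g q)⁻¹ • τ : ℍ)) : ℂ) 1 + I * Φ' ((((g q)⁻¹ • τ : ℍ)) : ℂ) I)) = 0 := by
  have hN : (0 : ℝ) < N := by exact_mod_cast Nat.pos_of_ne_zero (NeZero.ne N)
  have hM0 : 0 ≤ M := (norm_nonneg _).trans (hM UpperHalfPlane.I)
  have hM'0 : 0 ≤ M' := by
    have h := hM' Complex.I (by simp)
    rw [Complex.I_im, div_one] at h
    exact (norm_nonneg _).trans h
  -- notation
  set A : (↥𝒮ℒ ⧸ (Gamma0 N : Subgroup (GL (Fin 2) ℝ)).subgroupOf 𝒮ℒ) → SL(2, ℤ) :=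
    fun q ↦ (g q)⁻¹ with hA
  set u : (↥𝒮ℒ ⧸ (Gamma0 N : Subgroup (GL (Fin 2) ℝ)).subgroupOf 𝒮ℒ) → ℂ → ℂ :=
    fun q ↦ (⇑f ∣[(2 : ℤ)] A q) ∘ ofComplex with hu
  set dd : (↥𝒮ℒ ⧸ (Gamma0 N : Subgroup (GL (Fin 2) ℝ)).subgroupOf 𝒮ℒ) → ℂ → ℂ :=
    fun q z ↦ (1 : ℂ) / ((((A q) 1 0 : ℤ) : ℂ) * z + (((A q) 1 1 : ℤ) : ℂ)) ^ 2 with hdd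
  set a : (↥𝒮ℒ ⧸ (Gamma0 N : Subgroup (GL (Fin 2) ℝ)).subgroupOf 𝒮ℒ) → ℂ → ℂ :=
    fun q z ↦ u q z * ((Φ' (moebius (A q) z) 1 - I * Φ' (moebius (A q) z) I) / 2) * dd q z +
      (Φ ∘ ofComplex) (moebius (A q) z) * deriv (u q) z with ha
  set b : (↥𝒮ℒ ⧸ (Gamma0 N : Subgroup (GL (Fin 2) ℝ)).subgroupOf 𝒮ℒ) → ℂ → ℂ :=
    fun q z ↦ u q z * ((Φ' (moebius (A q) z) 1 + I * Φ' (moebius (A q) z) I) / 2) * conj (dd q z)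
    with hb
  set P : ℂ → ℂ := fun z ↦ ∑ q, u q z * (Φ ∘ ofComplex) (moebius (A q) z) with hP
  set P' : ℂ → (ℂ →L[ℝ] ℂ) := fun z ↦
    ∑ q, (a q z • ContinuousLinearMap.id ℝ ℂ + b q z • (conjCLE : ℂ →L[ℝ] ℂ)) with hP'
  have hcf : ∀ q, IsCuspFunction N (⇑f ∣[(2 : ℤ)] A q) := fun q ↦ isCuspFunction_slash f (A q)
  -- (1) derivative
  have hderiv : ∀ z : ℂ, 0 < z.im → HasFDerivAt P (P' z) z := fun z hz ↦
    HasFDerivAt.fun_sum fun q _ ↦ hasFDerivAt_term f (A q) hΦ hz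
  -- (2) continuity
  have hΦc : ContinuousOn (Φ ∘ ofComplex) {z : ℂ | 0 < z.im} := fun z hz ↦
    (hΦ z hz).continuousAt.continuousWithinAt
  have huc : ∀ q, ContinuousOn (u q) {z : ℂ | 0 < z.im} := fun q ↦
    HaberlandStokes.continuousOn_apply (hcf q)
  have hvc : ∀ q, ContinuousOn (fun z ↦ (Φ ∘ ofComplex) (moebius (A q) z)) {z : ℂ | 0 < z.im} :=
    fun q ↦ hΦc.comp (continuousOn_moebius (A q)) (mapsTo_moebius (A q))
  have hLc : ∀ q (v : ℂ), ContinuousOn (fun z ↦ Φ' (moebius (A q) z) v) {z : ℂ | 0 < z.im} :=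
    fun q v ↦ (ContinuousLinearMap.apply ℝ ℂ v).continuous.comp_continuousOn
      (hΦ'c.comp (continuousOn_moebius (A q)) (mapsTo_moebius (A q)))
  have hddc : ∀ q, ContinuousOn (dd q) {z : ℂ | 0 < z.im} := fun q ↦
    continuousOn_const.div (by fun_prop) fun z hz ↦ pow_ne_zero 2 (moebius_denom_ne_zero (A q) hz)
  have hu'c : ∀ q, ContinuousOn (deriv (u q)) {z : ℂ | 0 < z.im} := fun q ↦
    HaberlandStokes.continuousOn_deriv_comp_ofComplex (hcf q)
  have hac : ∀ q, ContinuousOn (a q) {z : ℂ | 0 < z.im} := fun q ↦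
    (((huc q).mul (((hLc q 1).sub (continuousOn_const.mul (hLc q I))).div_const _)).mul
      (hddc q)).add ((hvc q).mul (hu'c q))
  have hbc : ∀ q, ContinuousOn (b q) {z : ℂ | 0 < z.im} := fun q ↦
    ((huc q).mul (((hLc q 1).add (continuousOn_const.mul (hLc q I))).div_const _)).mul
      (continuous_conj.comp_continuousOn (hddc q))
  have hPc : ContinuousOn P {z : ℂ | 0 < z.im} :=
    continuousOn_finsetSum _ fun q _ ↦ (huc q).mul (hvc q)
  have hP'c : ContinuousOn P' {z : ℂ | 0 < z.im} :=
    continuousOn_finsetSum _ fun q _ ↦ HaberlandStokes.continuousOn_clm (hac q) (hbc q)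
  -- (3) bounds at height `≥ 2`, then down to `1/2`
  choose C hC0 hCb using fun q ↦ exists_bound_term f (A q) (Φ := Φ) (Φ' := Φ') hM0 hM'0 hM hM'
  set Ct : ℝ := ∑ q, C q with hCt
  have hPb2 : ∀ z : ℂ, z.re ∈ Icc (-(1 / 2) : ℝ) (1 / 2) → 2 ≤ z.im →
      ‖P z‖ ≤ Ct * Real.exp (-(2 * Real.pi / N) * z.im) := by
    intro z _ hz
    calc ‖P z‖ ≤ ∑ q, ‖u q z * (Φ ∘ ofComplex) (moebius (A q) z)‖ := norm_sum_le _ _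
      _ ≤ ∑ q, C q * Real.exp (-(2 * Real.pi / N) * z.im) :=
          Finset.sum_le_sum fun q _ ↦ (hCb q z hz).1
      _ = Ct * Real.exp (-(2 * Real.pi / N) * z.im) := by rw [hCt, Finset.sum_mul]
  have hP'b2 : ∀ z : ℂ, z.re ∈ Icc (-(1 / 2) : ℝ) (1 / 2) → 2 ≤ z.im →
      ‖P' z‖ ≤ (2 * Ct) * Real.exp (-(2 * Real.pi / N) * z.im) := by
    intro z _ hz
    calc ‖P' z‖ ≤ ∑ q, ‖a q z • ContinuousLinearMap.id ℝ ℂ + b q z • (conjCLE : ℂ →L[ℝ] ℂ)‖ :=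
          norm_sum_le _ _
      _ ≤ ∑ q, (‖a q z‖ + ‖b q z‖) := Finset.sum_le_sum fun q _ ↦ HaberlandStokes.norm_clm_le _ _
      _ ≤ ∑ q, (C q * Real.exp (-(2 * Real.pi / N) * z.im) + C q * Real.exp (-(2 * Real.pi / N) * z.im)) :=
          Finset.sum_le_sum fun q _ ↦ add_le_add (hCb q z hz).2.1 (hCb q z hz).2.2
      _ = (2 * Ct) * Real.exp (-(2 * Real.pi / N) * z.im) := by
          rw [hCt, Finset.mul_sum, Finset.sum_mul]
          refine Finset.sum_congr rfl fun q _ ↦ ?_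
          ring
  obtain ⟨CP, hCP0, hCP⟩ := HaberlandStokes.exists_bound_of_bound_ge (Q := P) hPc
    (a := -(1 / 2)) (b := 1 / 2) (Y := 2) (m := 1 / 2) (C := Ct) (c := 2 * Real.pi / N)
    one_half_pos hPb2
  obtain ⟨CP', hCP'0, hCP'⟩ := HaberlandStokes.exists_bound_of_bound_ge (Q := P') hP'c
    (a := -(1 / 2)) (b := 1 / 2) (Y := 2) (m := 1 / 2) (C := 2 * Ct) (c := 2 * Real.pi / N)
    one_half_pos hP'b2
  have hbP : ∀ z : ℂ, z.re ∈ Icc (-(1 / 2) : ℝ) (1 / 2) → 1 / 2 ≤ z.im →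
      ‖P z‖ ≤ max CP CP' * Real.exp (-(2 * Real.pi / N) * z.im) := fun z h1 h2 ↦
    (hCP z h1 h2).trans (mul_le_mul_of_nonneg_right (le_max_left _ _) (Real.exp_pos _).le)
  have hbP' : ∀ z : ℂ, z.re ∈ Icc (-(1 / 2) : ℝ) (1 / 2) → 1 / 2 ≤ z.im →
      ‖P' z‖ ≤ max CP CP' * Real.exp (-(2 * Real.pi / N) * z.im) := fun z h1 h2 ↦
    (hCP' z h1 h2).trans (mul_le_mul_of_nonneg_right (le_max_right _ _) (Real.exp_pos _).le)
  -- (4) `T`- and `S`-invariance of `P`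
  have hPτ : ∀ z : ℂ, 0 < z.im →
      P z = ∑ q, (⇑f ∣[(2 : ℤ)] A q) (ofComplex z) * Φ (A q • ofComplex z) := by
    intro z hz
    simp only [hP, hu, Function.comp_apply]
    simp_rw [← smul_ofComplex _ hz]
  have hT : ∀ z : ℂ, 0 < z.im → P (z + 1) = P z := by
    intro z hz
    have hz1 : 0 < (z + 1).im := by simpa using hz
    have hTz : ofComplex (z + 1) = T • ofComplex z := by rw [smul_ofComplex T hz, moebius_T]
    rw [hPτ _ hz1, hPτ _ hz, hTz]
    exact cosetSum_T_smul g hg f hinv (ofComplex z)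
  have hS : ∀ z : ℂ, 0 < z.im → P (-z⁻¹) = z ^ 2 * P z := by
    intro z hz
    have hz1 : 0 < (-z⁻¹).im := by rw [← moebius_S]; exact moebius_im_pos S hz
    have hSz : ofComplex (-z⁻¹) = S • ofComplex z := by rw [smul_ofComplex S hz, moebius_S]
    have hcoe : (((ofComplex z : ℍ)) : ℂ) = z := by
      rw [UpperHalfPlane.ofComplex_apply_of_im_pos hz]
    rw [hPτ _ hz1, hPτ _ hz, hSz, cosetSum_S_smul g hg f hinv (ofComplex z)]
    simp only [hcoe]
    rfl
  -- (5) Stokes on the standard fundamental domain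
  have hc : 0 < 2 * Real.pi / N := by positivity
  have hstokes := levelOne_stokes hderiv hP'c hbP hbP' ((hCP0).trans (le_max_left _ _)) hc hT hS
  -- (6) the integrand is `(i/y²) ∑_q K(g_q⁻¹ τ)`
  set Ψ : ℍ → ℂ := fun τ ↦ ∑ q, (((((A q • τ : ℍ)).im : ℝ) : ℂ) ^ 2 * f (A q • τ) *
      (Φ' (((A q • τ : ℍ)) : ℂ) 1 + I * Φ' (((A q • τ : ℍ)) : ℂ) I)) with hΨ
  have hpt : ∀ z : ℂ, 0 < z.im →
      I * P' z 1 - P' z I = I * (((1 / z.im ^ 2 : ℝ) : ℂ) * Ψ (ofComplex z)) := by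
    intro z hz
    simp only [hP', FunLike.coe_sum, Finset.sum_apply, Finset.mul_sum, ← Finset.sum_sub_distrib,
      stokes_integrand_clm, hΨ]
    refine Finset.sum_congr rfl fun q _ ↦ ?_
    simp only [hb]
    rw [coe_smul_ofComplex (A q) hz]
    have key := slash_mul_conj_inv_denom_sq f (A q) hz
    simp only [hu, hdd] at key ⊢
    linear_combination (I * ((Φ' (moebius (A q) z)) 1 + I * (Φ' (moebius (A q) z)) I)) * key
  -- (7) integrability of `Ψ` on `𝒟` (it is bounded and continuous)
  obtain ⟨Cf, hCf⟩ := CuspFormClass.exists_bound (k := 2)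
    (Γ := (Gamma0 N : Subgroup (GL (Fin 2) ℝ))) f
  have hCf' : ∀ σ : ℍ, σ.im * ‖f σ‖ ≤ Cf := by
    intro σ
    have h := hCf σ
    have h2 : σ.im ^ ((2 : ℤ) / 2 : ℝ) = σ.im := by norm_num
    rw [h2, le_div_iff₀ σ.im_pos] at h
    linarith
  have hKb : ∀ σ : ℍ, ‖(((σ.im : ℝ) : ℂ)) ^ 2 * f σ * (Φ' (σ : ℂ) 1 + I * Φ' (σ : ℂ) I)‖ ≤
      2 * Cf * M' := by
    intro σ
    have hL := hM' (σ : ℂ) σ.im_pos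
    rw [UpperHalfPlane.coe_im] at hL
    have hD : ‖Φ' (σ : ℂ) 1 + I * Φ' (σ : ℂ) I‖ ≤ 2 * (M' / σ.im) := by
      have h1 : ‖Φ' (σ : ℂ) 1‖ ≤ ‖Φ' (σ : ℂ)‖ := by simpa using (Φ' (σ : ℂ)).le_opNorm 1
      have hI : ‖I * Φ' (σ : ℂ) I‖ ≤ ‖Φ' (σ : ℂ)‖ := by
        rw [norm_mul, Complex.norm_I, one_mul]; simpa using (Φ' (σ : ℂ)).le_opNorm I
      have := norm_add_le (Φ' (σ : ℂ) 1) (I * Φ' (σ : ℂ) I)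
      linarith
    rw [norm_mul, norm_mul, norm_pow, Complex.norm_real, Real.norm_of_nonneg σ.im_pos.le]
    have hi := σ.im_pos
    calc σ.im ^ 2 * ‖f σ‖ * ‖Φ' (σ : ℂ) 1 + I * Φ' (σ : ℂ) I‖
        ≤ σ.im ^ 2 * ‖f σ‖ * (2 * (M' / σ.im)) := by gcongr
      _ = 2 * (σ.im * ‖f σ‖) * M' := by field_simp
      _ ≤ 2 * Cf * M' := by gcongr; exact hCf' σ
  have hsmulc : ∀ q, Continuous fun τ : ℍ ↦ A q • τ := fun q ↦ by
    change Continuous fun τ : ℍ ↦ (Matrix.SpecialLinearGroup.mapGL ℝ (A q) : GL (Fin 2) ℝ) • τ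
    exact continuous_const_smul _
  have hΦ'h : Continuous fun σ : ℍ ↦ Φ' (σ : ℂ) :=
    hΦ'c.comp_continuous UpperHalfPlane.continuous_coe fun σ ↦ σ.im_pos
  have hKc : Continuous fun σ : ℍ ↦
      (((σ.im : ℝ) : ℂ)) ^ 2 * f σ * (Φ' (σ : ℂ) 1 + I * Φ' (σ : ℂ) I) := by
    have hfc : Continuous (⇑f : ℍ → ℂ) := (ModularFormClass.holo f).continuous
    have h1 : Continuous fun σ : ℍ ↦ Φ' (σ : ℂ) 1 := (ContinuousLinearMap.apply ℝ ℂ 1).continuous.comp hΦ'h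
    have h2 : Continuous fun σ : ℍ ↦ Φ' (σ : ℂ) I := (ContinuousLinearMap.apply ℝ ℂ I).continuous.comp hΦ'h
    have h3 : Continuous fun σ : ℍ ↦ (((σ.im : ℝ) : ℂ)) :=
      Complex.continuous_ofReal.comp UpperHalfPlane.continuous_im
    exact ((h3.pow 2).mul hfc).mul (h1.add (continuous_const.mul h2))
  have hΨc : Continuous Ψ := continuous_finsetSum _ fun q _ ↦ hKc.comp (hsmulc q)
  have hint : IntegrableOn Ψ 𝒟 := by
    refine Measure.integrableOn_of_bounded volume_fd_lt_top.ne hΨc.aestronglyMeasurable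
      (M := (Finset.univ : Finset (↥𝒮ℒ ⧸ (Gamma0 N : Subgroup (GL (Fin 2) ℝ)).subgroupOf 𝒮ℒ)).card •
        (2 * Cf * M')) (ae_of_all _ fun τ ↦ ?_)
    calc ‖Ψ τ‖ ≤ ∑ q, ‖(((((A q • τ : ℍ)).im : ℝ) : ℂ)) ^ 2 * f (A q • τ) *
          (Φ' (((A q • τ : ℍ)) : ℂ) 1 + I * Φ' (((A q • τ : ℍ)) : ℂ) I)‖ := norm_sum_le _ _
      _ ≤ ∑ _q : (↥𝒮ℒ ⧸ (Gamma0 N : Subgroup (GL (Fin 2) ℝ)).subgroupOf 𝒮ℒ), 2 * Cf * M' :=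
          Finset.sum_le_sum fun q _ ↦ hKb _
      _ = (Finset.univ : Finset (↥𝒮ℒ ⧸ (Gamma0 N : Subgroup (GL (Fin 2) ℝ)).subgroupOf 𝒮ℒ)).card •
            (2 * Cf * M') := Finset.sum_const _
  have hΨ' := (FdCoord.integrableOn_image_iff Ψ ModularGroup.isClosed_fd.measurableSet).mpr hint
  -- (8) conclusion
  have hcongr : ∫ x in (-(1 / 2) : ℝ)..(1 / 2), ∫ t in Ioi (Real.sqrt (1 - x ^ 2)),
      (I * P' ((x : ℂ) + t * I) 1 - P' ((x : ℂ) + t * I) I) =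
      ∫ x in (-(1 / 2) : ℝ)..(1 / 2), ∫ t in Ioi (Real.sqrt (1 - x ^ 2)),
        I * (((1 / t ^ 2 : ℝ) : ℂ) * Ψ (ofComplex ((x : ℂ) + t * I))) := by
    refine intervalIntegral.integral_congr fun x hx ↦ ?_
    rw [uIcc_of_le (by norm_num)] at hx
    refine setIntegral_congr_fun measurableSet_Ioi fun t ht ↦ ?_
    have ht0 : 0 < t :=
      (lt_of_lt_of_le one_half_pos (HaberlandStokes.half_le_arc hx)).trans (mem_Ioi.mp ht)
    have him : ((x : ℂ) + t * I).im = t := by simp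
    have h := hpt ((x : ℂ) + t * I) (by rw [him]; exact ht0)
    rw [him] at h
    exact h
  have hI : ∫ x in (-(1 / 2) : ℝ)..(1 / 2), ∫ t in Ioi (Real.sqrt (1 - x ^ 2)),
      I * (((1 / t ^ 2 : ℝ) : ℂ) * Ψ (ofComplex ((x : ℂ) + t * I))) =
      I * ∫ x in (-(1 / 2) : ℝ)..(1 / 2), ∫ t in Ioi (Real.sqrt (1 - x ^ 2)),
        ((1 / t ^ 2 : ℝ) : ℂ) * Ψ (ofComplex ((x : ℂ) + t * I)) := by
    rw [← intervalIntegral.integral_const_mul]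
    refine intervalIntegral.integral_congr fun x _ ↦ ?_
    exact integral_const_mul _ _
  rw [hcongr, hI] at hstokes
  show ∫ τ in 𝒟, Ψ τ = 0
  rw [FdCoord.setIntegral_fd_eq_intervalIntegral Ψ hΨ']
  exact (mul_eq_zero.mp hstokes).resolve_left Complex.I_ne_zero

end Term

end QuotientStokes

end Literature.NumberTheory.EllipticCurves.ModularForms

end
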